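import Summits.QuantumFields.BalabanUV.Beta.EriceRemainderEnclosureHistoryAutonomyComparisonDualDiminishingRow
import Summits.QuantumFields.BalabanUV.Beta.EriceRemainderEnclosureHistoryAutonomyComparisonDualComparison

/-!
# EriceRemainderEnclosureHistoryAutonomyComparisonDualDiminishingGauge — (E137c) **THE GAUGE STEP FOR NON-SEPARABLE MEMORY WITH DIMINISHING RETURNS.**  Setting of
# (E137a∕b): memory `B` of range `K` on the closed box, isotone, diminishing returns, coordinatewise concave, `B(0) > 0` (the floor); modulus, unique box solutions;
# `B′ ≥ B` with ISOTONE excess, one perturbed orbit `h′`, dual steps `X′_m`, gauge `g_m = X′_m·h′_m²`.  **`dr_gauge_step`**: if `X′_m ≥ 0` and `g_{m+1} ≤ g_m` for all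
# `m ≥ n+1` then `X′_n ≥ 0` and `g_{n+1} ≤ g_n` — (E134) `gauge_step` ∕ (E136b) `concave_gauge_step` with the STAIRCASE chord slopes `λ_k` ((E137b) `dr_row_ge`; the window and
# rise lemmas of (E134) are base-general).  The per-age budget is (E136b)'s («the first entry is paid inside the window share»: `λ(σ²x∕2) + u0·λ(x − x³∕u1) ≤ u0·λ·x` from
# (E132) `base_gap_damped`), and the SHARES are summed by (E137a) `stair_budget`: `Σ_k λ_k x_k ≤ B(x) − B(0) ≤ B(tail_1 S h′_n) − B(0)` and, for the deficit coefficient,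
# `Σ_k λ_k x_{k+1} ≤ B(tail_1 S h′_{n+1}) − B(0) ≤ 1∕u1 − B(0)` — the floor `B(0) > 0` gives the strict slack.

Cell `pub-balaban`, β-function sub-cell, BINDER row D4 «RemainderConst leaves for Bałaban's split» (`HOME/BINDER-OWNERS.md`; owner lineage `b2b-balaban-beta-an4`;
this file by co-owner #2 lineage `b2b-balaban-beta-d4-p2`, generation 105), β-FLOW TEAM duty (1), FREEZE (0) honoured (def-free; imports (E137b) and (E135b); uses (E137a)
`cbox_of_seqBox` ∕ `stair_budget`, (E137b) `dr_row_ge`, (E135a) `gauge_of_row`, (E134) `steps_mul_le_rise` ∕ `cmp_from_pin` ∕ `pert_step_le_level` ∕ `gauge_window_le`, (E133)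
`coupling_gap_le` ∕ `dual_two_pin_le`, (E132) `base_gap_damped`, (E48a) `family_zero` ∕ `family_mem` ∕ `family_tail_eq` ∕ `le_of_pin_le` ∕ `strictAnti_of_memFlow` BY NAME; nothing
restated).

HONEST FRAMING (page 1, verbatim and binding).  *"Discharging BetaPertH makes Bałaban's UV stability UNCONDITIONAL — a real constructive-QFT result; it is
NOT the continuum limit and NOT the Clay problem."*  THIS FILE DISCHARGES NOTHING OF THE KIND.  Elementary real analysis about ABSTRACT functionals on a box
]0,γ]^ℕ — hypotheses of a census, not facts; the form, signs, ages, moments and convexity of Bałaban's (1.22) limit functional are NOT PRINTED ([I] p. 298; GAPS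
G-t4-U2-1∕-2) and NOT asserted.  Row D4 class UNCHANGED (critical-path width 0; instance 0∕1; D4 DISCHARGE NO DATE).  NOT CLAIMED here: the comparison theorem (the
sequel (E137d)); anything printed — NOT B12 Thm 2, NOT BetaPertH, NOT continuum, NOT Clay.

WHAT IS PROVED ([folklore]; 0 `def`, 0 sorry).  `dr_step_le_excess`, **`dr_gauge_step`**.
-/

noncomputable section
open Finset Set

namespace Summit.QuantumFields.BalabanUV.Beta.EriceRemainderEnclosureHistoryAutonomyComparisonDualDiminishingGauge

open Literature.MathematicalPhysics.QuantumFieldTheory.Balaban1983to89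
open Literature.MathematicalPhysics.QuantumFieldTheory.Balaban1983to89.T4BetaStationary
open Literature.MathematicalPhysics.QuantumFieldTheory.Balaban1983to89.T4BetaFlowWellPosed
open Summit.QuantumFields.BalabanUV.Beta.EriceRemainderEnclosureHistoryAutonomyOrder
  (family_zero family_mem family_tail_eq family_succ_eq le_of_pin_le strictAnti_of_memFlow)
open Summit.QuantumFields.BalabanUV.Beta.EriceRemainderEnclosureHistoryAutonomyComparisonDualOrbit
  (base_gap_damped dual_source_antitone dual_gap_le_sum_steps cmp_of_dual_steps_nonneg)
open Summit.QuantumFields.BalabanUV.Beta.EriceRemainderEnclosureHistoryAutonomyComparisonDualRow (coupling_gap_le dual_two_pin_le)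
open Summit.QuantumFields.BalabanUV.Beta.EriceRemainderEnclosureHistoryAutonomyComparisonDualGauge
  (steps_mul_le_rise cmp_from_pin source_chain pert_step_le_level gauge_window_le)
open Summit.QuantumFields.BalabanUV.Beta.EriceRemainderEnclosureHistoryAutonomyComparisonDualDeep (gauge_of_row)
open Summit.QuantumFields.BalabanUV.Beta.EriceRemainderEnclosureHistoryAutonomyComparisonDualComparison (level_ge_floor)
open Summit.QuantumFields.BalabanUV.Beta.EriceRemainderEnclosureHistoryAutonomyComparisonDualDiminishingShares
  (cbox_of_seqBox stair_budget)
open Summit.QuantumFields.BalabanUV.Beta.EriceRemainderEnclosureHistoryAutonomyComparisonDualDiminishingRow (dr_row_ge)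

variable {B B' : (ℕ → ℝ) → ℝ} {M γ b : ℝ} {K : ℕ} {S : ℝ → ℕ → ℝ} {h' : ℕ → ℝ}

/-! ## §1 The gauge step for diminishing-returns memory -/

/-- THE DUAL STEP NEVER EXCEEDS THE EXCESS (isotone memory): under comparison from the pin `h′_m`, `X′_m ≤ E_m`, because the drop
`B(tail_1 S h′_m) − B(tail_{m+1}h′)` is non-negative. [folklore] -/
theorem dr_step_le_excess
    (hmono : ∀ u v : ℕ → ℝ, SeqBox γ u → SeqBox γ v → (∀ i, u i ≤ v i) → B u ≤ B v)
    (hS : ∀ p, 0 < p → p ≤ γ → SeqBox γ (S p) ∧ MemFlow B p (S p)) (hh' : SeqBox γ h') (m : ℕ)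
    (hcmp : ∀ l, h' (m + l) ≤ S (h' m) l) :
    B' (fun i => h' (m + 1 + i)) - B (fun i => S (h' m) (1 + i))
      ≤ B' (fun i => h' (m + 1 + i)) - B (fun i => h' (m + 1 + i)) := by
  have : B (fun i => h' (m + 1 + i)) ≤ B (fun i => S (h' m) (1 + i)) :=
    hmono _ _ (fun i => hh' (m + 1 + i)) (fun i => (hS (h' m) (hh' m).1 (hh' m).2).1 (1 + i)) fun i => by
      have hc := hcmp (1 + i); rwa [show m + (1 + i) = m + 1 + i by ring] at hc
  linarith

set_option maxHeartbeats 800000 in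
/-- **THE GAUGE STEP FOR NON-SEPARABLE MEMORY WITH DIMINISHING RETURNS.**  `B` of range `K` on the closed box: isotone, diminishing returns, coordinatewise concave, floor
`B(0) > 0`; modulus, unique box solutions `S p`; `B′ ≥ B` with ISOTONE excess, `h′` a box solution of `B′`, dual steps `X′_m`, gauge `g_m = X′_m·h′_m²`.  If `X′_m ≥ 0` and
`g_{m+1} ≤ g_m` for every `m ≥ n+1`, then `X′_n ≥ 0` and `g_{n+1} ≤ g_n` — (E136b) `concave_gauge_step` with the staircase chord slopes; the shares are summed by (E137a)
`stair_budget` (`Σ λ_k x_k ≤ B(x) − B(0)`, `Σ λ_k x_{k+1} ≤ B(x_{1+·}) − B(0)`). [folklore] -/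
theorem dr_gauge_step (hK : ∀ u v : ℕ → ℝ, (∀ j, j < K → u j = v j) → B u = B v)
    (hmonoC : ∀ u v : ℕ → ℝ, (∀ j, 0 ≤ u j ∧ u j ≤ γ) → (∀ j, 0 ≤ v j ∧ v j ≤ γ) → (∀ j, u j ≤ v j) → B u ≤ B v)
    (hDR : ∀ u v : ℕ → ℝ, (∀ j, 0 ≤ u j ∧ u j ≤ γ) → (∀ j, 0 ≤ v j ∧ v j ≤ γ) → (∀ j, u j ≤ v j) → ∀ (k : ℕ) (a c : ℝ), 0 ≤ a → a ≤ c → c ≤ γ →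
      B (Function.update v k c) - B (Function.update v k a) ≤ B (Function.update u k c) - B (Function.update u k a))
    (hconc : ∀ u : ℕ → ℝ, (∀ j, 0 ≤ u j ∧ u j ≤ γ) → ∀ (k : ℕ) (a c d e : ℝ), 0 ≤ a → a < c → 0 ≤ d → d < e → a ≤ d → c ≤ e → e ≤ γ →
      (B (Function.update u k e) - B (Function.update u k d)) * (c - a) ≤ (B (Function.update u k c) - B (Function.update u k a)) * (e - d))
    (hB0 : 0 < B (fun _ => 0))
    (hb : 0 < b)
    (hmono : ∀ u v : ℕ → ℝ, SeqBox γ u → SeqBox γ v → (∀ i, u i ≤ v i) → B u ≤ B v)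
    (hB : ∀ u u' : ℕ → ℝ, SeqBox γ u → SeqBox γ u' → ∀ D : ℝ, (∀ j, |u j - u' j| ≤ D) → |B u - B u'| ≤ M * D) (hM : 0 ≤ M)
    (hlo : ∀ u, SeqBox γ u → b ≤ B u)
    (hS : ∀ p, 0 < p → p ≤ γ → SeqBox γ (S p) ∧ MemFlow B p (S p))
    (huniq : ∀ p, 0 < p → p ≤ γ → ∀ u u' : ℕ → ℝ, SeqBox γ u → SeqBox γ u' → MemFlow B p u → MemFlow B p u' → u = u')
    (hexc : ∀ u, SeqBox γ u → B u ≤ B' u)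
    (hDmono : ∀ u v : ℕ → ℝ, SeqBox γ u → SeqBox γ v → (∀ i, u i ≤ v i) → B' u - B u ≤ B' v - B v)
    (hh' : SeqBox γ h') {y : ℝ} (hf' : MemFlow B' y h') (n : ℕ)
    (hXup : ∀ l, 0 ≤ B' (fun i => h' (n + 1 + l + 1 + i)) - B (fun i => S (h' (n + 1 + l)) (1 + i)))
    (hg : ∀ m, n + 1 ≤ m → (B' (fun i => h' (m + 1 + 1 + i)) - B (fun i => S (h' (m + 1)) (1 + i))) * h' (m + 1) ^ 2
      ≤ (B' (fun i => h' (m + 1 + i)) - B (fun i => S (h' m) (1 + i))) * h' m ^ 2) :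
    0 ≤ B' (fun i => h' (n + 1 + i)) - B (fun i => S (h' n) (1 + i))
      ∧ (B' (fun i => h' (n + 1 + 1 + i)) - B (fun i => S (h' (n + 1)) (1 + i))) * h' (n + 1) ^ 2
        ≤ (B' (fun i => h' (n + 1 + i)) - B (fun i => S (h' n) (1 + i))) * h' n ^ 2 := by
  -- derived facts
  have hmono' : ∀ u v : ℕ → ℝ, SeqBox γ u → SeqBox γ v → (∀ i, u i ≤ v i) → B' u ≤ B' v := fun u v hu hv hle => by
    linarith [hmono u v hu hv hle, hDmono u v hu hv hle]
  have hlo' : ∀ u, SeqBox γ u → b ≤ B' u := fun u hu => (hlo u hu).trans (hexc u hu)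
  have hanti : Antitone h' := (strictAnti_of_memFlow hb hlo' hh' hf').antitone
  have hpos : ∀ j, 0 < h' j := fun j => (hh' j).1
  have hcmp : ∀ l, h' (n + 1 + l) ≤ S (h' (n + 1)) l := cmp_from_pin (B' := B') hb hB hM hlo hS huniq hh' hf' (n + 1) hXup
  have hp1 := hh' (n + 1)
  have hpn := hh' n
  have hS1 := hS (h' (n + 1)) hp1.1 hp1.2
  have hSn := hS (h' n) hpn.1 hpn.2
  have hxpos : ∀ k, 0 < S (h' (n + 1)) k := fun k => (hS1.1 k).1
  have hx0 : S (h' (n + 1)) 0 = h' (n + 1) := family_zero hS hp1.1 hp1.2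
  have hxanti' := strictAnti_of_memFlow hb hlo hS1.1 hS1.2
  have hxanti := hxanti'.antitone
  have hσanti := (strictAnti_of_memFlow hb hlo hSn.1 hSn.2).antitone
  set X0 : ℝ := B' (fun i => h' (n + 1 + i)) - B (fun i => S (h' n) (1 + i)) with hX0
  set X1 : ℝ := B' (fun i => h' (n + 1 + 1 + i)) - B (fun i => S (h' (n + 1)) (1 + i)) with hX1
  set u0 : ℝ := h' n ^ 2 with hu0
  set u1 : ℝ := h' (n + 1) ^ 2 with hu1
  set B0 : ℝ := B (fun _ => 0) with hB0def
  -- the staircase chord slopes and their budget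
  set lam : ℕ → ℝ := fun k => (B (fun j => if j < k + 1 then S (h' (n + 1)) j else S (h' (n + 1)) (j + 1))
      - B (fun j => if j < k then S (h' (n + 1)) j else S (h' (n + 1)) (j + 1))) / (S (h' (n + 1)) k - S (h' (n + 1)) (k + 1)) with hlamdef
  obtain ⟨hlam0, hbud1, hbud2⟩ := stair_budget hK hmonoC hDR hconc hS1.1 hxanti'
  have hu0p : 0 < u0 := pow_pos (hpos n) 2
  have hu1p : 0 < u1 := pow_pos (hpos (n + 1)) 2
  have hu10 : u1 ≤ u0 := pow_le_pow_left₀ (hpos _).le (hanti (Nat.le_succ n)) 2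
  have hX1nn : 0 ≤ X1 := by have := hXup 0; simp only [Nat.add_zero] at this; exact this
  have hlev0 : X0 = 1 / h' (n + 1) ^ 2 - 1 / h' n ^ 2 - B (fun i => S (h' n) (1 + i)) := by rw [hX0, hf'.2 n]; ring
  have hlev1 : B' (fun i => h' (n + 1 + 1 + i)) = 1 / h' (n + 1 + 1) ^ 2 - 1 / h' (n + 1) ^ 2 := by rw [hf'.2 (n + 1)]; ring
  have hΦ00 : B (fun i => S (h' (n + 1)) (1 + i)) ≤ 1 / u1 := by
    have h1 : B (fun i => S (h' (n + 1)) (1 + i)) ≤ B' (fun i => h' (n + 1 + 1 + i)) := by linarith [hX1nn]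
    have h2 := pert_step_le_level hmono' hb hlo' hh' hf' (m := n + 1) (by omega)
    rw [hlev1] at h1; simp only [hu1]; linarith
  have exs : (fun j => S (h' (n + 1)) (j + 1)) = (fun i => S (h' (n + 1)) (1 + i)) := by funext i; rw [Nat.add_comm i 1]
  rw [exs] at hbud2
  -- the row inequality
  have hrow := dr_row_ge (B' := B') hK hmonoC hDR hconc hB0.le hb hmono hB hM hlo hS huniq hlo' hDmono hh' hf' n hcmp hXup
  -- the deficit sum through the gauge
  set C : ℝ := ∑ k ∈ range K, lam k * (S (h' (n + 1)) k - S (h' (n + 1)) k ^ 3 / u1) with hC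
  have hdef : ∑ k ∈ range K, lam k * (S (h' (n + 1)) k ^ 3 * (1 / S (h' (n + 1)) (k + 1) ^ 2 - 1 / S (h' (n + 1)) k ^ 2)
        * (h' (n + 1 + k) ^ 2 * (1 / h' (n + 1 + k) ^ 2 - 1 / S (h' (n + 1)) k ^ 2))) ≤ X1 * u1 * C := by
    rw [hC, mul_sum]
    refine sum_le_sum fun k _ => ?_
    have hw := gauge_window_le (B' := B') hb hmono hB hM hlo hS huniq hh' hanti hf' n k hXup hg
    have hrise := steps_mul_le_rise hmono hb hlo hS1.1 hS1.2 k
    rw [hx0] at hrise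
    have hxk := hxpos k
    have hΦk : 0 ≤ 1 / S (h' (n + 1)) (k + 1) ^ 2 - 1 / S (h' (n + 1)) k ^ 2 := by
      rw [hS1.2.2 k]; linarith [hlo _ (seqBox_shift hS1.1 (k + 1))]
    have hg1 : 0 ≤ X1 * u1 := mul_nonneg hX1nn hu1p.le
    have step1 : S (h' (n + 1)) k ^ 3 * (1 / S (h' (n + 1)) (k + 1) ^ 2 - 1 / S (h' (n + 1)) k ^ 2)
        * (h' (n + 1 + k) ^ 2 * (1 / h' (n + 1 + k) ^ 2 - 1 / S (h' (n + 1)) k ^ 2))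
        ≤ S (h' (n + 1)) k ^ 3 * (1 / S (h' (n + 1)) (k + 1) ^ 2 - 1 / S (h' (n + 1)) k ^ 2) * ((k : ℝ) * (X1 * u1)) :=
      mul_le_mul_of_nonneg_left hw (by positivity)
    have step2 : S (h' (n + 1)) k ^ 3 * ((k : ℝ) * (1 / S (h' (n + 1)) (k + 1) ^ 2 - 1 / S (h' (n + 1)) k ^ 2))
        ≤ S (h' (n + 1)) k ^ 3 * (1 / S (h' (n + 1)) k ^ 2 - 1 / h' (n + 1) ^ 2) :=
      mul_le_mul_of_nonneg_left hrise (by positivity)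
    have e3 : S (h' (n + 1)) k ^ 3 * (1 / S (h' (n + 1)) k ^ 2 - 1 / h' (n + 1) ^ 2) = S (h' (n + 1)) k - S (h' (n + 1)) k ^ 3 / u1 := by
      simp only [hu1]; field_simp
    have step3 := mul_le_mul_of_nonneg_left step2 hg1
    rw [e3] at step3
    have hk : S (h' (n + 1)) k ^ 3 * (1 / S (h' (n + 1)) (k + 1) ^ 2 - 1 / S (h' (n + 1)) k ^ 2)
        * (h' (n + 1 + k) ^ 2 * (1 / h' (n + 1 + k) ^ 2 - 1 / S (h' (n + 1)) k ^ 2))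
        ≤ X1 * u1 * (S (h' (n + 1)) k - S (h' (n + 1)) k ^ 3 / u1) :=
      calc _ ≤ S (h' (n + 1)) k ^ 3 * (1 / S (h' (n + 1)) (k + 1) ^ 2 - 1 / S (h' (n + 1)) k ^ 2) * ((k : ℝ) * (X1 * u1)) := step1
        _ = X1 * u1 * (S (h' (n + 1)) k ^ 3 * ((k : ℝ) * (1 / S (h' (n + 1)) (k + 1) ^ 2 - 1 / S (h' (n + 1)) k ^ 2))) := by ring
        _ ≤ X1 * u1 * (S (h' (n + 1)) k - S (h' (n + 1)) k ^ 3 / u1) := step3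
    have := mul_le_mul_of_nonneg_left hk (hlam0 k)
    linarith [this]
  -- the coefficient C is paid by the budget at the pin h′_{n+1}:  C ≤ Σ λ_k x_{k+1} ≤ B(tail_1 S h′_{n+1}) − B(0),  u1·C ≤ 1 − u1·B(0) < 1
  have hCle : C ≤ B (fun i => S (h' (n + 1)) (1 + i)) - B0 := by
    refine le_trans ?_ hbud2
    rw [hC]
    refine sum_le_sum fun k _ => ?_
    have hxk := hxpos k
    have hxk1 := hxpos (k + 1)
    have hle : S (h' (n + 1)) (k + 1) ≤ S (h' (n + 1)) k := hxanti (Nat.le_succ k)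
    have hgap := coupling_gap_le hxk1 hle
    have hΦk : 1 / S (h' (n + 1)) (k + 1) ^ 2 - 1 / S (h' (n + 1)) k ^ 2 ≤ 1 / u1 := by
      have e1 : 1 / S (h' (n + 1)) (k + 1) ^ 2 - 1 / S (h' (n + 1)) k ^ 2 = B (fun i => S (h' (n + 1)) (k + 1 + i)) := by
        rw [hS1.2.2 k]; ring
      have hdec : B (fun i => S (h' (n + 1)) (k + 1 + i)) ≤ B (fun i => S (h' (n + 1)) (0 + 1 + i)) :=
        hmono _ _ (seqBox_shift hS1.1 (k + 1)) (seqBox_shift hS1.1 (0 + 1)) fun i => hxanti (by omega)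
      have e0 : (fun i => S (h' (n + 1)) (0 + 1 + i)) = (fun i => S (h' (n + 1)) (1 + i)) := by funext i; simp
      rw [e0] at hdec
      rw [e1]; exact hdec.trans hΦ00
    have h1 : (1 / S (h' (n + 1)) (k + 1) ^ 2 - 1 / S (h' (n + 1)) k ^ 2) * (S (h' (n + 1)) k ^ 2 * S (h' (n + 1)) (k + 1) / 2)
        ≤ 1 / u1 * (S (h' (n + 1)) k ^ 2 * S (h' (n + 1)) k / 2) :=
      mul_le_mul hΦk (by nlinarith [mul_le_mul_of_nonneg_left hle (sq_nonneg (S (h' (n + 1)) k))]) (by positivity) (by positivity)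
    have h2 : 1 / u1 * (S (h' (n + 1)) k ^ 2 * S (h' (n + 1)) k / 2) ≤ S (h' (n + 1)) k ^ 3 / u1 := by
      rw [le_div_iff₀ hu1p]
      have e : 1 / u1 * (S (h' (n + 1)) k ^ 2 * S (h' (n + 1)) k / 2) * u1 = S (h' (n + 1)) k ^ 3 / 2 := by field_simp
      rw [e]; nlinarith [pow_pos hxk 3]
    -- λ·(x − x³/u1) ≤ λ·x₊
    have h3 : S (h' (n + 1)) k - S (h' (n + 1)) k ^ 3 / u1 ≤ S (h' (n + 1)) (k + 1) := by linarith [hgap, h1, h2]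
    exact mul_le_mul_of_nonneg_left h3 (hlam0 k)
  have hbudget1 : u1 * (B (fun i => S (h' (n + 1)) (1 + i)) - B0) ≤ 1 - u1 * B0 := by
    have := mul_le_mul_of_nonneg_left hΦ00 hu1p.le
    rw [mul_one_div_cancel hu1p.ne'] at this
    nlinarith [this]
  have hC1 : u1 * C < 1 := by
    have := mul_le_mul_of_nonneg_left hCle hu1p.le
    nlinarith [mul_pos hu1p hB0]
  -- the two cases of the sign of X′_n
  by_cases h0 : 0 ≤ X0
  · refine ⟨h0, ?_⟩
    rw [max_eq_left h0] at hrow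
    have hle1 : h' (n + 1) ≤ S (h' n) 1 := by
      have hσ1 := (hSn.1 1).1
      refine (pow_le_pow_iff_left₀ (hpos (n + 1)).le hσ1.le two_ne_zero).mp
        ((one_div_le_one_div (pow_pos hσ1 2) (pow_pos (hpos (n + 1)) 2)).mp ?_)
      have : 0 ≤ 1 / h' (n + 1) ^ 2 - 1 / h' n ^ 2 - B (fun i => S (h' n) (1 + i)) := by rw [← hlev0]; exact h0
      have e2 : 1 / S (h' n) (0 + 1) ^ 2 = 1 / S (h' n) 0 ^ 2 + B (fun i => S (h' n) (0 + 1 + i)) := hSn.2.2 0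
      rw [family_zero hS hpn.1 hpn.2] at e2
      have e3 : (fun i => S (h' n) (0 + 1 + i)) = (fun i => S (h' n) (1 + i)) := by funext i; simp
      rw [e3] at e2; simp only [Nat.zero_add] at e2
      linarith
    -- the two base orbits from (S h′_n)_1 and h′_{n+1}: level gap at age k ≤ pin gap = X0 ≤ Φ′_n = 1/u1 − 1/u0
    have hz := family_mem hS hpn.1 hpn.2 1
    have htail : (fun j => S (h' n) (1 + j)) = S (S (h' n) 1) := family_tail_eq hS huniq hpn.1 hpn.2 1
    have hkz := hS (S (h' n) 1) hz.1 hz.2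
    have hleS : ∀ j, S (h' (n + 1)) j ≤ S (S (h' n) 1) j := fun j =>
      le_of_pin_le hb hB hM hlo huniq hp1.1 hle1 hz.2 hS1.1 hkz.1 hS1.2 hkz.2 j
    have hpin : 1 / h' (n + 1) ^ 2 - 1 / S (h' n) 1 ^ 2 ≤ 1 / u1 - 1 / u0 := by
      have hB00 : 0 ≤ B (fun i => S (h' n) (1 + i)) := hb.le.trans (hlo _ (fun i => hSn.1 (1 + i)))
      have e2 : 1 / S (h' n) (0 + 1) ^ 2 = 1 / S (h' n) 0 ^ 2 + B (fun i => S (h' n) (0 + 1 + i)) := hSn.2.2 0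
      rw [family_zero hS hpn.1 hpn.2] at e2
      have e3 : (fun i => S (h' n) (0 + 1 + i)) = (fun i => S (h' n) (1 + i)) := by funext i; simp
      rw [e3] at e2; simp only [Nat.zero_add] at e2
      simp only [hu0, hu1]; linarith
    have hgapk : ∀ k, 1 / S (h' (n + 1)) k ^ 2 - 1 / S (h' n) (1 + k) ^ 2 ≤ 1 / u1 - 1 / u0 := by
      intro k
      have h1 := base_gap_damped hmono hkz.1 hkz.2 hS1.1 hS1.2 hleS k
      rw [← congrFun htail k] at h1
      exact h1.trans hpin
    -- the share budget: Σ λ_k x_k ≤ B(x) − B(0) ≤ B(tail_1 S h′_n) − B(0)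
    have hxσ : B (S (h' (n + 1))) ≤ B (fun i => S (h' n) (1 + i)) := by
      rw [htail]; exact hmono _ _ hS1.1 hkz.1 hleS
    -- the row condition, age by age: λ(σ²x/2) + u0·λ(x − x³/u1) ≤ u0·λ·x
    have hcond : ∑ k ∈ range K, lam k * (S (h' n) (1 + k) ^ 2 * S (h' (n + 1)) k / 2) + u0 * C
        ≤ u0 * (B (fun i => S (h' n) (1 + i)) - B0) := by
      have hper : ∑ k ∈ range K, lam k * (S (h' n) (1 + k) ^ 2 * S (h' (n + 1)) k / 2) + u0 * C
          ≤ u0 * ∑ k ∈ range K, lam k * S (h' (n + 1)) k := by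
        rw [hC, mul_sum, mul_sum, ← sum_add_distrib]
        refine sum_le_sum fun k _ => ?_
        have hl0 := hlam0 k
        have hxk := hxpos k
        have hσ := (hSn.1 (1 + k)).1
        have hσu0 : S (h' n) (1 + k) ^ 2 ≤ u0 := by
          have : S (h' n) (1 + k) ≤ S (h' n) 0 := hσanti (Nat.zero_le _)
          rw [family_zero hS hpn.1 hpn.2] at this
          exact pow_le_pow_left₀ hσ.le this 2
        -- from the level gap: σ²·u1 ≤ x²(σ² + u1) ≤ 2·u0·x²
        have hgk := hgapk k
        have hkey : S (h' n) (1 + k) ^ 2 * u1 ≤ 2 * u0 * S (h' (n + 1)) k ^ 2 := by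
          have hx2 : 0 < S (h' (n + 1)) k ^ 2 := pow_pos hxk 2
          have hs2 : 0 < S (h' n) (1 + k) ^ 2 := pow_pos hσ 2
          have h1 : 1 / S (h' (n + 1)) k ^ 2 ≤ 1 / u1 + 1 / S (h' n) (1 + k) ^ 2 := by
            have : 0 < 1 / u0 := by positivity
            linarith
          have h2 := mul_le_mul_of_nonneg_left h1 (by positivity : (0:ℝ) ≤ S (h' (n + 1)) k ^ 2 * S (h' n) (1 + k) ^ 2 * u1)
          have e1 : S (h' (n + 1)) k ^ 2 * S (h' n) (1 + k) ^ 2 * u1 * (1 / S (h' (n + 1)) k ^ 2) = S (h' n) (1 + k) ^ 2 * u1 := by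
            field_simp
          have e2 : S (h' (n + 1)) k ^ 2 * S (h' n) (1 + k) ^ 2 * u1 * (1 / u1 + 1 / S (h' n) (1 + k) ^ 2)
              = S (h' (n + 1)) k ^ 2 * (S (h' n) (1 + k) ^ 2 + u1) := by
            field_simp
          rw [e1, e2] at h2
          nlinarith [hσu0, hu10, hx2]
        have hstep : S (h' n) (1 + k) ^ 2 * S (h' (n + 1)) k / 2 + u0 * (S (h' (n + 1)) k - S (h' (n + 1)) k ^ 3 / u1)
            ≤ u0 * S (h' (n + 1)) k := by
          have : S (h' n) (1 + k) ^ 2 * S (h' (n + 1)) k / 2 ≤ u0 * S (h' (n + 1)) k ^ 3 / u1 := by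
            rw [le_div_iff₀ hu1p]; nlinarith [hkey, hxk]
          have e : u0 * (S (h' (n + 1)) k - S (h' (n + 1)) k ^ 3 / u1) = u0 * S (h' (n + 1)) k - u0 * S (h' (n + 1)) k ^ 3 / u1 := by ring
          linarith [this, e]
        have := mul_le_mul_of_nonneg_left hstep hl0
        nlinarith [this]
      have hsum : ∑ k ∈ range K, lam k * S (h' (n + 1)) k ≤ B (fun i => S (h' n) (1 + i)) - B0 := by linarith [hbud1, hxσ]
      exact hper.trans (mul_le_mul_of_nonneg_left hsum hu0p.le)
    have hΦ0 : B (fun i => S (h' n) (1 + i)) ≤ 1 / u1 - 1 / u0 := by rw [hlev0] at h0; simp only [hu0, hu1]; linarith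
    exact gauge_of_row (Sg := B (fun i => S (h' n) (1 + i)) - B0) hu0p hu1p hB0 h0 hrow hdef hC1 hcond rfl hΦ0
  · exfalso
    have h0' : X0 < 0 := lt_of_not_ge h0
    rw [max_eq_right h0'.le, zero_mul, sub_zero] at hrow
    have A1 : X1 * (1 - u1 * C) ≤ X0 := by nlinarith [hrow, hdef]
    have A2 : 0 ≤ X1 * (1 - u1 * C) := mul_nonneg hX1nn (by linarith)
    linarith

end Summit.QuantumFields.BalabanUV.Beta.EriceRemainderEnclosureHistoryAutonomyComparisonDualDiminishingGauge

end
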